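import Summits.ResolutionOfSingularities.ResolutionOfSingularities.Theorems.HomologicalConductorNoZenoRFirstKindClosedImage
import Summits.ResolutionOfSingularities.ResolutionOfSingularities.Theorems.HomologicalConductorNoZenoRMinimalOfCriterionMUnconditional
import Summits.ResolutionOfSingularities.ResolutionOfSingularities.Theorems.HomologicalConductorNoZenoRCriterionM
import Summits.ResolutionOfSingularities.ResolutionOfSingularities.Theorems.HomologicalConductorNoZenoSandwichRegularCorner
import Literature.AlgebraicGeometry.Resolution.AdicCompletionRegular
import Literature.AlgebraicGeometry.Resolution.ProjectiveSpaceRegular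
import HarnessLib

/-!
# Crux `NoZenoR` (stmt-ResolutionOfSingularities-19943) — the INDUCTION SHELL of the Castelnuovo-free road:
# «the minimal desingularization of a rational surface singularity has no first-kind curve» (M₀), and with it the W3
# print `Lipman1969_27_3_rat`, FOLLOW from ONE localisation step [B]+[U] (stated here as an explicit hypothesis)

Route `ResolutionOfSingularities/HomologicalConductor` (cell decomp-res, hand leafhand-res-homologicalconduct-24 g0).
OURS: AI-written bookkeeping over tree theorems, weaker than expert review; nothing here is a statement of the
manuscript under review (Hironaka 2017).  SUPPORT level, counted 0.  Def-free, fact-free; the theorems are CONDITIONAL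
on the explicit hypothesis `hstep` (no named Literature fact).

`hstep` (the localisation step of memo MEMO-19943-hand24g0-M0-ROAD.md, [B]+[U], fed by this hand's [G]
`isClosed_singleton_apply_of_firstKind`): for a NON-regular rational `S`, a MINIMAL desingularization `π : X → Spec S`
and a first-kind integral exceptional curve `E_η`, there are a rational `S₁` (the local ring of the quadratic transform at
the closed point `σ η`), a MINIMAL desingularization `π₁ : X₁ → Spec S₁` (the base change of `X → Bl_𝔪 Spec S`) with
FEWER integral exceptional curves, and a first-kind curve on it (the lift of `E_η`).

* `not_firstKind_of_isMinimalResolution_of_step` — `hstep` ⇒ **(M₀)**: no first-kind curve on a minimal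
  desingularization of a rational `S` (strong induction on `#excCurvePoints`; regular `S`: a minimal desingularization
  of a regular scheme is an isomorphism and has no exceptional curve, tree `ExcCount.isIso_of_isMinimalResolution_of_isRegular`,
  `ExcCount.excCurvePoints_eq_empty_of_isIso`);
* `Lipman1969_27_3_rat_of_step` — `hstep` ⇒ **the W3 print `Lipman1969_27_3_rat.{0}`** («⇐» is the tree's
  unconditional `isMinimalResolution_of_criterionM`; «⇒» is (M₀) with `3·h⁰(𝓘_η) ≤ h⁰(𝓘_η²)`,
  `MinimalNoFirstKind.three_mul_h0_le_h0_sq_holds`).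

No crux or summit statement is proved here; `hstep` is NOT proved here (sizes in the memo: [B] M/L, [U] M).
-/

noncomputable section

-- single-problem summit: the doubled namespace component `ResolutionOfSingularities` is forced
set_option linter.dupNamespace false

open CategoryTheory CategoryTheory.Limits AlgebraicGeometry TopologicalSpace IsLocalRing
open Literature.AlgebraicGeometry.Resolution

namespace Summit.ResolutionOfSingularities.ResolutionOfSingularities.Theorems.NoZeno.FirstKind

/-- **(M₀) from the localisation step.**  If every first-kind curve on a minimal desingularization of a NON-regular
rational `S` reappears on a minimal desingularization of some rational `S₁` with fewer integral exceptional curves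
(`hstep`), then NO minimal desingularization of a rational two-dimensional Noetherian local normal domain carries a
first-kind curve. [cite: Lipman1969, Corollary (27.3) (p. 277)] -/
theorem not_firstKind_of_isMinimalResolution_of_step
    (hstep : ∀ (S : Type) [CommRing S] [IsNoetherianRing S] [IsLocalRing S] [IsDomain S] [IsIntegrallyClosed S],
      ringKrullDim S = 2 → HasRationalSingularity S → ¬ IsRegularLocalRing S →
      ∀ (X : Scheme.{0}) (π : X ⟶ Spec (.of S)), IsMinimalResolution π →
      ∀ η ∈ excCurvePoints π, h0 π (primeDivisorIdeal η ^ 2) = 3 * h0 π (primeDivisorIdeal η) →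
      ∃ (S₁ : Type) (_ : CommRing S₁) (_ : IsNoetherianRing S₁) (_ : IsLocalRing S₁) (_ : IsDomain S₁)
        (_ : IsIntegrallyClosed S₁), ringKrullDim S₁ = 2 ∧ HasRationalSingularity S₁ ∧
        ∃ (X₁ : Scheme.{0}) (π₁ : X₁ ⟶ Spec (.of S₁)), IsMinimalResolution π₁ ∧
          (excCurvePoints π₁).ncard < (excCurvePoints π).ncard ∧
          ∃ η₁ ∈ excCurvePoints π₁, h0 π₁ (primeDivisorIdeal η₁ ^ 2) = 3 * h0 π₁ (primeDivisorIdeal η₁))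
    (S : Type) [CommRing S] [IsNoetherianRing S] [IsLocalRing S] [IsDomain S] [IsIntegrallyClosed S]
    (hdim : ringKrullDim S = 2) (hrat : HasRationalSingularity S)
    {X : Scheme.{0}} {π : X ⟶ Spec (.of S)} (hπ : IsMinimalResolution π)
    {η : X} (hη : η ∈ excCurvePoints π) :
    h0 π (primeDivisorIdeal η ^ 2) ≠ 3 * h0 π (primeDivisorIdeal η) := by
  -- strong induction on the number of integral exceptional curves, over all `(S, X, π, η)`
  suffices H : ∀ (n : ℕ) (S : Type) [CommRing S] [IsNoetherianRing S] [IsLocalRing S] [IsDomain S]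
      [IsIntegrallyClosed S], ringKrullDim S = 2 → HasRationalSingularity S →
      ∀ (X : Scheme.{0}) (π : X ⟶ Spec (.of S)), IsMinimalResolution π → (excCurvePoints π).ncard = n →
      ∀ η ∈ excCurvePoints π, h0 π (primeDivisorIdeal η ^ 2) ≠ 3 * h0 π (primeDivisorIdeal η) from
    H _ S hdim hrat X π hπ rfl η hη
  intro n
  induction n using Nat.strong_induction_on with
  | _ n ih =>
    intro S _ _ _ _ _ hdim hrat X π hπ hn η hη hfk
    by_cases hreg : IsRegularLocalRing S
    · -- a minimal desingularization of a regular `Spec S` is an isomorphism: no exceptional curve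
      haveI : IsRegularRing (CommRingCat.of S) := isRegularRing_of_isRegularLocalRing S
      haveI := ExcCount.isIso_of_isMinimalResolution_of_isRegular hπ (Scheme.isRegular_Spec (.of S))
      have hempty := ExcCount.excCurvePoints_eq_empty_of_isIso π
      rw [hempty] at hη
      exact hη
    · obtain ⟨S₁, _, _, _, _, _, hdim₁, hrat₁, X₁, π₁, hπ₁, hlt, η₁, hη₁, hfk₁⟩ :=
        hstep S hdim hrat hreg X π hπ η hη hfk
      exact ih _ (hn ▸ hlt) S₁ hdim₁ hrat₁ X₁ π₁ hπ₁ rfl η₁ hη₁ hfk₁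

/-- **The W3 print `Lipman1969_27_3_rat.{0}` from the localisation step** (`hstep` as above): «⇐» is the tree's
unconditional `isMinimalResolution_of_criterionM`; «⇒»: on a minimal desingularization `3·h⁰(𝓘_η) ≤ h⁰(𝓘_η²)`
always (`three_mul_h0_le_h0_sq_holds`) and equality (first kind) is excluded by (M₀).
[cite: Lipman1969, Corollary (27.3) (p. 277)] -/
theorem Lipman1969_27_3_rat_of_step
    (hstep : ∀ (S : Type) [CommRing S] [IsNoetherianRing S] [IsLocalRing S] [IsDomain S] [IsIntegrallyClosed S],
      ringKrullDim S = 2 → HasRationalSingularity S → ¬ IsRegularLocalRing S →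
      ∀ (X : Scheme.{0}) (π : X ⟶ Spec (.of S)), IsMinimalResolution π →
      ∀ η ∈ excCurvePoints π, h0 π (primeDivisorIdeal η ^ 2) = 3 * h0 π (primeDivisorIdeal η) →
      ∃ (S₁ : Type) (_ : CommRing S₁) (_ : IsNoetherianRing S₁) (_ : IsLocalRing S₁) (_ : IsDomain S₁)
        (_ : IsIntegrallyClosed S₁), ringKrullDim S₁ = 2 ∧ HasRationalSingularity S₁ ∧
        ∃ (X₁ : Scheme.{0}) (π₁ : X₁ ⟶ Spec (.of S₁)), IsMinimalResolution π₁ ∧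
          (excCurvePoints π₁).ncard < (excCurvePoints π).ncard ∧
          ∃ η₁ ∈ excCurvePoints π₁, h0 π₁ (primeDivisorIdeal η₁ ^ 2) = 3 * h0 π₁ (primeDivisorIdeal η₁)) :
    Lipman1969_27_3_rat.{0} := by
  intro S _ _ _ _ _ hdim hrat X π hπres
  constructor
  · intro hmin η hη
    exact lt_of_le_of_ne (ExcCount.MinimalNoFirstKind.three_mul_h0_le_h0_sq_holds hdim hrat hπres hη)
      (Ne.symm (not_firstKind_of_isMinimalResolution_of_step hstep S hdim hrat hmin hη))
  · intro hM
    exact isMinimalResolution_of_criterionM hdim hrat hπres hM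

end Summit.ResolutionOfSingularities.ResolutionOfSingularities.Theorems.NoZeno.FirstKind

end
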